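import Literature.NumberTheory.PAdicHodge.AinfWeierstrassRamifiedCellsWitness
import Literature.NumberTheory.PAdicHodge.AinfRamifiedOmegaPeriodNonvanishingVarpi
import Literature.NumberTheory.PAdicHodge.AinfRamifiedTateModule
import HarnessLib

/-!
# (N1′) for the K★ cell models in the Tate-module currency of the transported reciprocity law: `∃ τ ∈ T_pŴ♭(𝒪_{ℂ_F}), ∫_{(τₙ)} ω_{W_D} ≠ 0`

Topic `Literature/NumberTheory/PAdicHodge`; namespace `Literature.NumberTheory.PAdicHodge.AinfRamTop`. THEOREMS ONLY (no definition, no named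
fact, no instance, no `sorry`). Assembly of `AinfWeierstrassRamifiedCellsWitness.exists_tatePtO_norm_p_lt_norm_pow_model` (a Tate-module point `τ`
of `W♭ = W_D ⊗_β 𝒪_F` with `τ₁ ≠ 0`, unconditionally for the cell models) and `AinfRamifiedOmegaPeriodNonvanishingVarpi.omegaPeriod_model_five_ne_zero` /
`…seven…` (`∫_t ω ≠ 0` for every `[p]`-compatible `t` with `t₀ = 0`, `t₁ ≠ 0`), read on the coordinate sequence `t = seqO τ` (`AinfRamifiedTateModule`:
`seqO_zero`, `mulPC_seqO`). For `D = (X^e − p, ϖ)`, `p ∈ {5, 7}`, `W_D = ⟨0,0,0,a ϱ^{r₄}, b ϱ^{r₆}⟩` over `𝒪_D` read over `CoeffDisc D`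
(`Wm := W_D.map (CoeffDisc.of D)`), a bridge `ψ : CoeffDisc D → 𝒪_F` over `F` (`hψ`), and the cell numerology
(`(e, r₄) ∈ {(3,1), (6,4)}` at `5`, `(e, r₆) = (4, 2)` at `7`, `3r₄ = e t₄`, `2r₆ = e t₆`, `64a³p^{t₄} + 432b²p^{t₆} ∈ ℤ_pˣ`):

* ★ `exists_tatePtO_omegaPeriod_seqO_ne_zero_model` — **`∃ τ : T_pŴ♭(𝒪_{ℂ_F}), ∫_{seqO τ} ω_{W_D} ≠ 0`**, literally the hypothesis `hN1'` of
  `BmaxPlusTransportedReciprocityFormalPoint` / `Summits/…/…TransportedReciprocity(Transport|OfVariableChange)` (Kato's explicit reciprocity law for the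
  ramified cells) at `Wm`, `ψm := ψ`, `hθ` arbitrary.

Purpose: crux K★ `stmt-BirchSwinnertonDyer-22226` (route `EdixhovenFibreFiveSeven`, line `kato_lever`), memo
`Summits/…/Cruxes/StarredOptimalManinUnitFiveSeven/Lines/kato-lever-K2-transport-allpoints.md` §2 item 2. Infrastructure only; BSD / K★ are not proved by this.

## References
* J.-M. Fontaine, *Formes différentielles et modules de Tate…*, Invent. Math. 65 (1982), §5. [Fontaine1982FormesDifferentielles]
* J.-P. Serre, Invent. Math. 15 (1972), §1.11. [Serre1972]
* J. H. Silverman, *AEC* (2009), III §7, IV.7.5, Prop. VII.2.2. [SilvermanAEC2009]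
-/

noncomputable section

open scoped Classical
open Ideal Field ValuativeRel Polynomial

namespace Literature.NumberTheory.PAdicHodge

open Literature.NumberTheory.GaloisRepresentations
open Literature.NumberTheory.GaloisRepresentations.IsNonarchimedeanLocalField
open Literature.NumberTheory.GaloisRepresentations.LubinTate
open Literature.NumberTheory.EllipticCurves

namespace AinfRamTop

variable {F : Type} [Field F] [ValuativeRel F] [TopologicalSpace F] [IsNonarchimedeanLocalField F] [CharZero F]
  {p : ℕ} [Fact p.Prime] [Fact (¬ IsUnit (p : integerC F))] [IsAdicComplete (Ideal.span {(p : integerC F)}) (integerC F)]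
  {hp : valuation F p < 1} {D : EisensteinRoot F p hp} [CharP 𝓀[F] p]
  {hθ : Function.Surjective (WittVector.fontaineTheta (integerC F) p)} {e : ℕ}
  (hD : D.poly = X ^ e - C (p : ℤ_[p])) (a b : ℤ_[p]) {r₄ r₆ t₄ t₆ : ℕ}
  (ψ : EisensteinRoot.CoeffDisc D →+* LTCoeff F) (hψ : ∀ c, algebraMap (LTCoeff F) F (ψ c) = EisensteinRoot.CoeffDisc.toF D c)

include hD hψ in
/-- ★ **(N1′) for the cell models, in the Tate-module currency**: for `p ∈ {5, 7}` and the model `W_D = ⟨0,0,0,a ϱ^{r₄}, b ϱ^{r₆}⟩` over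
`𝒪_D = ℤ_p[X]/(X^e − p)` with the cell numerology, there is `τ ∈ T_pŴ♭(𝒪_{ℂ_F})` (`W♭ = W_D ⊗_ψ 𝒪_F`) whose coordinate sequence `t = seqO τ`
(`t₀ = 0`, `[p]_{W_D} t_{n+1} = t_n`) has **`∫_t ω_{W_D} ≠ 0`**: a `τ` with `τ₁ ≠ 0` (`exists_tatePtO_norm_p_lt_norm_pow_model`) and the cells'
`omegaPeriod_model_five_ne_zero` / `omegaPeriod_model_seven_ne_zero`. [cite: Fontaine1982FormesDifferentielles, §5] [cite: Serre1972, §1.11]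
[cite: SilvermanAEC2009, IV.7.5] -/
theorem exists_tatePtO_omegaPeriod_seqO_ne_zero_model (hp57 : p = 5 ∨ p = 7)
    (h5 : p = 5 → e = 3 ∧ r₄ = 1 ∨ e = 6 ∧ r₄ = 4) (h7 : p = 7 → e = 4 ∧ r₆ = 2)
    (h₄ : 3 * r₄ = e * t₄) (h₆ : 2 * r₆ = e * t₆) (hu : IsUnit (64 * a ^ 3 * (p : ℤ_[p]) ^ t₄ + 432 * b ^ 2 * (p : ℤ_[p]) ^ t₆)) :
    ∃ τ : AinfTop.TatePtO F ((((⟨0, 0, 0, AdjoinRoot.of D.poly a * AdjoinRoot.root D.poly ^ r₄,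
        AdjoinRoot.of D.poly b * AdjoinRoot.root D.poly ^ r₆⟩ : WeierstrassCurve D.Coeff).map
        (EisensteinRoot.CoeffDisc.of D).toRingHom)).map ψ) p,
      omegaPeriod (((⟨0, 0, 0, AdjoinRoot.of D.poly a * AdjoinRoot.root D.poly ^ r₄,
          AdjoinRoot.of D.poly b * AdjoinRoot.root D.poly ^ r₆⟩ : WeierstrassCurve D.Coeff).map
          (EisensteinRoot.CoeffDisc.of D).toRingHom)) hθ
        (AinfTop.seqO _ τ) (AinfTop.seqO_zero _ τ) (mulPC_seqO _ ψ hψ τ) ≠ 0 := by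
  have hr₄ : p = 5 → 0 < r₄ := fun h => by rcases h5 h with ⟨-, h'⟩ | ⟨-, h'⟩ <;> omega
  have hr₆ : p = 7 → 0 < r₆ := fun h => by obtain ⟨-, h'⟩ := h7 h; omega
  -- the Tate-module witness of the bridge `β := ψ ∘ (CoeffDisc.of D)` (`(W_D.map of).map ψ = W_D.map β` definitionally)
  obtain ⟨τ, h1, -⟩ := AinfTop.exists_tatePtO_norm_p_lt_norm_pow_model hD (ψ.comp (EisensteinRoot.CoeffDisc.of D).toRingHom) a b
    hp57 h₄ h₆ hu hr₄ hr₆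
  refine ⟨τ, ?_⟩
  have h1' : (AinfTop.seqO ((((⟨0, 0, 0, AdjoinRoot.of D.poly a * AdjoinRoot.root D.poly ^ r₄,
      AdjoinRoot.of D.poly b * AdjoinRoot.root D.poly ^ r₆⟩ : WeierstrassCurve D.Coeff).map
      (EisensteinRoot.CoeffDisc.of D).toRingHom)).map ψ) τ 1 : CBall F) ≠ 0 := fun h =>
    h1 ((congrArg (fun y : CBall F => (y : CompletedAlgClosure F)) h).trans rfl)
  rcases hp57 with rfl | rfl
  · exact omegaPeriod_model_five_ne_zero hD a b (h5 rfl) h₄ h₆ hu _ _ h1'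
  · exact omegaPeriod_model_seven_ne_zero hD a b (h7 rfl) h₄ h₆ hu _ _ h1'

end AinfRamTop

end Literature.NumberTheory.PAdicHodge

end
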